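import Summits.Ventures.PercRepro.RankLevelSetAvgPairs

/-!
# PercRepro — `num_ge`, PART 1: THE CHARGING OF `k·Φ(p−1,q)` TO THE TERMS OF `NUM′` (night-1, gen 10; dossier §20)

`Φ(p−1,q) = Σ_{t=1}^{d−2} C(p−1,t)/C(q+t,q)` (`phiK_pred_eq`; `d = p − q`, `u = q + t`, `C(N,q+t)·C(q+t,q) = C(N,q)·C(p−1,t)`),
and `C(p−1,t) = Σ_i C(k,i)·C(p−k−1,t−i)` (Vandermonde), so `k·Φ′` is a sum of terms `phiTerm t i`.  Every such term is
charged to ONE index `(σ,j)` of `NUM′ = Σ_{σ=1}^{k} Σ_{j=1}^{d−1} ν(σ,j)`: `(t,i)` with `i ≥ 1`, `j = t − i ≥ 1` to `(i,j)`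
(`demA`); the `i = 0` terms to `(1,t)` (`demB`); the `j = 0` terms to `(i,1)` (`demC`).  The total charge `dem(σ,j)`
satisfies `k·Φ′ ≤ Σ_{σ,j} dem(σ,j)` (`mul_phiK_le_sum_dem`).  Also the exact value `m̄(σ,1) = C(q+σ,q) + [k<q]·C(q+σ,q−1)`
and the Vandermonde bound `m̄(σ,j) ≤ C(q+σ+j,q)`.  Part 2 (RankLevelSetNumGe) shows `dem(σ,j) ≤ ν(σ,j)` for `q ≤ 10`.

Axioms: standard.
-/

namespace PercRepro

open Finset

/-! ### The multiplicity count `m̄` -/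

/-- Vandermonde: `m̄(q,k,s₁,s₂) ≤ C(q + s₁ + s₂, q)` (the sum over ALL `j ≤ q`). -/
lemma mbar_le_choose (q k s₁ s₂ : ℕ) : mbar q k s₁ s₂ ≤ (q + s₁ + s₂).choose q := by
  unfold mbar
  have hV : ∑ j ∈ Finset.range (q + 1), (s₂.choose j) * ((q + s₁).choose (q - j)) = (s₂ + (q + s₁)).choose q := by
    have h := Nat.add_choose_eq s₂ (q + s₁) q
    rw [Finset.Nat.sum_antidiagonal_eq_sum_range_succ (fun i j => s₂.choose i * (q + s₁).choose j) q] at h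
    exact h.symm
  rw [show q + s₁ + s₂ = s₂ + (q + s₁) by ring, ← hV]
  apply Finset.sum_le_sum_of_subset_of_nonneg
  · intro j hj
    rw [Finset.mem_range] at hj ⊢
    omega
  · intro _ _ _
    exact Nat.zero_le _

/-- The exact value at `s₂ = 1`: `m̄(q,k,s₁,1) = C(q+s₁,q) + [k < q]·C(q+s₁,q−1)`. -/
lemma mbar_one_eq (q k s₁ : ℕ) :
    mbar q k s₁ 1 = (q + s₁).choose q + (if k < q then (q + s₁).choose (q - 1) else 0) := by
  unfold mbar
  rcases Nat.lt_or_ge k q with hlt | hge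
  · have h2 : q - k + 1 = (q - k - 1) + 1 + 1 := by omega
    rw [h2, Finset.sum_range_succ', Finset.sum_range_succ', if_pos hlt]
    have hz : ∀ i ∈ Finset.range (q - k - 1), Nat.choose 1 (i + 1 + 1) * (q + s₁).choose (q - (i + 1 + 1)) = 0 := by
      intro i _
      rw [Nat.choose_eq_zero_of_lt (by omega)]
      simp
    rw [Finset.sum_eq_zero hz]
    simp [add_comm]
  · have h1 : q - k + 1 = 1 := by omega
    rw [h1, Finset.sum_range_one, if_neg (by omega)]
    simp

/-- `m̄(q,q,s₁,1) = C(q+s₁,q)`. -/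
lemma mbar_one_of_eq (q s₁ : ℕ) : mbar q q s₁ 1 = (q + s₁).choose q := by
  rw [mbar_one_eq, if_neg (lt_irrefl q), add_zero]

/-- `m̄(q,k,s₁,1) = C(q+s₁+1,q)` when `k < q`. -/
lemma mbar_one_of_lt {q k : ℕ} (s₁ : ℕ) (hk : k < q) : mbar q k s₁ 1 = (q + s₁ + 1).choose q := by
  rw [mbar_one_eq, if_pos hk]
  obtain ⟨q', rfl⟩ : ∃ q', q = q' + 1 := ⟨q - 1, by omega⟩
  rw [show q' + 1 + s₁ + 1 = (q' + s₁ + 1) + 1 by ring, Nat.choose_succ_succ',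
    show q' + 1 - 1 = q' by omega, show q' + 1 + s₁ = q' + s₁ + 1 by ring, add_comm]

/-! ### `Φ(p−1,q)` as a sum over `t = u − q` -/

/-- `Φ(p−1,q) = Σ_{t=1}^{p−q−2} C(p−1,t)/C(q+t,q)` for `q + 2 ≤ p`. -/
lemma phiK_pred_eq {p q : ℕ} (hpq : q + 2 ≤ p) :
    phiK (p - 1) q = ∑ t ∈ Finset.Icc 1 (p - q - 2), ((p - 1).choose t : ℚ) / ((q + t).choose q : ℚ) := by
  unfold phiK
  rw [Finset.sum_div]
  have hsymm : (p - 1 + q).choose (p - 1) = (p - 1 + q).choose q := Nat.choose_symm_add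
  rw [hsymm]
  refine Finset.sum_nbij' (fun u => u - q) (fun t => q + t) ?_ ?_ ?_ ?_ ?_
  · intro u hu
    rw [Finset.mem_Ioo] at hu
    rw [Finset.mem_Icc]
    omega
  · intro t ht
    rw [Finset.mem_Icc] at ht
    rw [Finset.mem_Ioo]
    omega
  · intro u hu
    rw [Finset.mem_Ioo] at hu
    omega
  · intro t _
    omega
  · intro u hu
    rw [Finset.mem_Ioo] at hu
    have hqu : q ≤ u := by omega
    have hN : p - 1 + q - q = p - 1 := by omega
    have hmul := Nat.choose_mul (n := p - 1 + q) (k := u) (s := q) hqu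
    rw [hN] at hmul
    have hpos1 : (0 : ℚ) < ((p - 1 + q).choose q : ℚ) := by
      exact_mod_cast Nat.choose_pos (by omega)
    have hpos2 : (0 : ℚ) < ((q + (u - q)).choose q : ℚ) := by
      exact_mod_cast Nat.choose_pos (by omega)
    rw [div_eq_div_iff hpos1.ne' hpos2.ne']
    have hq' : q + (u - q) = u := by omega
    rw [hq', mul_comm (((p - 1).choose (u - q) : ℕ) : ℚ)]
    exact_mod_cast hmul

/-! ### Vandermonde for `C(p−1,t)` -/

/-- `C(p−1,t) = Σ_{i ≤ t} C(k,i)·C(p−k−1,t−i)` for `k + 1 ≤ p`. -/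
lemma choose_pred_eq_sum {p k : ℕ} (hk : k + 1 ≤ p) (t : ℕ) :
    (p - 1).choose t = ∑ i ∈ Finset.range (t + 1), k.choose i * (p - k - 1).choose (t - i) := by
  have h := Nat.add_choose_eq k (p - k - 1) t
  rw [Finset.Nat.sum_antidiagonal_eq_sum_range_succ (fun i j => k.choose i * (p - k - 1).choose j) t] at h
  rw [show k + (p - k - 1) = p - 1 by omega] at h
  exact h

/-! ### The charge `dem(σ,j)` of the terms of `k·Φ(p−1,q)` at the `NUM′`-index `(σ,j)` -/

/-- The term `(t,i)` of `k·Φ′`: `k·C(k,i)·C(p−k−1,t−i)/C(q+t,q)`. -/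
noncomputable def phiTerm (p q k t i : ℕ) : ℚ :=
  (k : ℚ) * (k.choose i : ℚ) * ((p - k - 1).choose (t - i) : ℚ) / ((q + t).choose q : ℚ)

/-- `[j+2 ≤ p−q]·k·C(p−k−1,j)/C(q+j,q)`: the `i = 0` terms, charged to `(1,j)`. -/
noncomputable def demB (p q k j : ℕ) : ℚ :=
  if j + 2 ≤ p - q then (k : ℚ) * ((p - k - 1).choose j : ℚ) / ((q + j).choose q : ℚ) else 0

/-- `[σ+j+2 ≤ p−q]·k·C(k,σ)·C(p−k−1,j)/C(q+σ+j,q)`: the term `(t,i) = (σ+j,σ)`, charged to `(σ,j)`. -/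
noncomputable def demA (p q k σ j : ℕ) : ℚ :=
  if σ + j + 2 ≤ p - q then
    (k : ℚ) * (k.choose σ : ℚ) * ((p - k - 1).choose j : ℚ) / ((q + σ + j).choose q : ℚ) else 0

/-- `[σ+2 ≤ p−q]·k·C(k,σ)/C(q+σ,q)`: the `j = 0` terms `(t,i) = (σ,σ)`, charged to `(σ,1)`. -/
noncomputable def demC (p q k σ : ℕ) : ℚ :=
  if σ + 2 ≤ p - q then (k : ℚ) * (k.choose σ : ℚ) / ((q + σ).choose q : ℚ) else 0

/-- The total charge at `(σ,j)`. -/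
noncomputable def dem (p q k σ j : ℕ) : ℚ :=
  (if σ = 1 then demB p q k j else 0) + demA p q k σ j + (if j = 1 then demC p q k σ else 0)

/-- `phiTerm ≥ 0`. -/
lemma phiTerm_nonneg (p q k t i : ℕ) : 0 ≤ phiTerm p q k t i := by
  unfold phiTerm; positivity

/-- `demB ≥ 0`. -/
lemma demB_nonneg (p q k j : ℕ) : 0 ≤ demB p q k j := by
  unfold demB; split_ifs <;> positivity

/-- `demA ≥ 0`. -/
lemma demA_nonneg (p q k σ j : ℕ) : 0 ≤ demA p q k σ j := by
  unfold demA; split_ifs <;> positivity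

/-- `demC ≥ 0`. -/
lemma demC_nonneg (p q k σ : ℕ) : 0 ≤ demC p q k σ := by
  unfold demC; split_ifs <;> positivity

/-- `dem ≥ 0`. -/
lemma dem_nonneg (p q k σ j : ℕ) : 0 ≤ dem p q k σ j := by
  unfold dem
  have := demB_nonneg p q k j
  have := demA_nonneg p q k σ j
  have := demC_nonneg p q k σ
  split_ifs <;> linarith

/-- `k·Φ(p−1,q) = Σ_{t=1}^{d−2} Σ_{i ≤ t} phiTerm t i`. -/
lemma mul_phiK_eq_sum_phiTerm {p q k : ℕ} (hpq : q + 2 ≤ p) (hk : k + 1 ≤ p) :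
    (k : ℚ) * phiK (p - 1) q =
      ∑ t ∈ Finset.Icc 1 (p - q - 2), ∑ i ∈ Finset.range (t + 1), phiTerm p q k t i := by
  rw [phiK_pred_eq hpq, Finset.mul_sum]
  refine Finset.sum_congr rfl (fun t _ => ?_)
  rw [choose_pred_eq_sum hk t]
  push_cast
  rw [Finset.sum_div, Finset.mul_sum]
  refine Finset.sum_congr rfl (fun i _ => ?_)
  unfold phiTerm
  ring

/-- The `i = 0` term is `demB`. -/
lemma phiTerm_zero {p q k t : ℕ} (ht : t + 2 ≤ p - q) : phiTerm p q k t 0 = demB p q k t := by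
  unfold phiTerm demB
  rw [if_pos ht]
  simp

/-- The `i = t` term is `demC`. -/
lemma phiTerm_self {p q k t : ℕ} (ht : t + 2 ≤ p - q) : phiTerm p q k t t = demC p q k t := by
  unfold phiTerm demC
  rw [if_pos ht]
  simp

/-- The term `(σ + j, σ)` is `demA σ j`. -/
lemma phiTerm_add {p q k σ j : ℕ} (h : σ + j + 2 ≤ p - q) : phiTerm p q k (σ + j) σ = demA p q k σ j := by
  unfold phiTerm demA
  rw [if_pos h, Nat.add_sub_cancel_left, add_assoc]

/-- `phiTerm t i = 0` for `i > k`. -/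
lemma phiTerm_eq_zero_of_lt {p q k t i : ℕ} (h : k < i) : phiTerm p q k t i = 0 := by
  unfold phiTerm
  rw [Nat.choose_eq_zero_of_lt h]
  simp

/-- Split the inner sum: `Σ_{i ≤ t} = (i = 0) + (i = t) + Σ_{1 ≤ i ≤ t−1}` for `t ≥ 1`. -/
lemma sum_range_split {M : Type*} [AddCommMonoid M] (f : ℕ → M) {t : ℕ} (ht : 1 ≤ t) :
    ∑ i ∈ Finset.range (t + 1), f i = f 0 + f t + ∑ i ∈ Finset.range (t - 1), f (i + 1) := by
  obtain ⟨m, rfl⟩ : ∃ m, t = m + 1 := ⟨t - 1, by omega⟩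
  rw [Finset.sum_range_succ', Finset.sum_range_succ, Nat.add_sub_cancel]
  abel

/-- The middle part of the `(t,i)`-sum, rewritten over `σ ∈ [1,k]` with the indicator `σ + 1 ≤ t`. -/
lemma sum_middle_eq {p q k t : ℕ} :
    ∑ i ∈ Finset.range (t - 1), phiTerm p q k t (i + 1) =
      ∑ σ ∈ Finset.Icc 1 k, (if σ + 1 ≤ t then phiTerm p q k t σ else 0) := by
  rw [Finset.sum_ite, Finset.sum_const_zero, add_zero]
  rw [Finset.range_eq_Ico, Finset.sum_Ico_add' (fun i => phiTerm p q k t i) 0 (t - 1) 1]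
  symm
  apply Finset.sum_subset
  · intro x hx
    simp only [Finset.mem_filter, Finset.mem_Icc] at hx
    simp only [Finset.mem_Ico]
    omega
  · intro x hx hx'
    simp only [Finset.mem_Ico] at hx
    simp only [Finset.mem_filter, Finset.mem_Icc, not_and, not_le] at hx'
    apply phiTerm_eq_zero_of_lt
    rcases Nat.lt_or_ge k x with hlt | hge
    · exact hlt
    · exfalso
      have := hx' ⟨by omega, hge⟩
      omega

/-- For fixed `σ`, the `t`-sum of the middle part equals the `j`-sum of `demA σ j`. -/
lemma sum_middle_sigma_eq {p q k σ : ℕ} :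
    ∑ t ∈ Finset.Icc 1 (p - q - 2), (if σ + 1 ≤ t then phiTerm p q k t σ else 0) =
      ∑ j ∈ Finset.Icc 1 (p - q - 1), demA p q k σ j := by
  rw [Finset.sum_ite, Finset.sum_const_zero, add_zero]
  have hset : (Finset.Icc 1 (p - q - 2)).filter (fun t => σ + 1 ≤ t) =
      (Finset.Icc 1 (p - q - 2 - σ)).image (σ + ·) := by
    rw [Finset.image_add_left_Icc]
    ext x
    simp only [Finset.mem_filter, Finset.mem_Icc]
    omega
  rw [hset, Finset.sum_image (by intro x _ y _ h; simpa using h)]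
  unfold demA
  rw [Finset.sum_ite, Finset.sum_const_zero, add_zero]
  have hset2 : (Finset.Icc 1 (p - q - 1)).filter (fun j => σ + j + 2 ≤ p - q) = Finset.Icc 1 (p - q - 2 - σ) := by
    ext x
    simp only [Finset.mem_filter, Finset.mem_Icc]
    omega
  rw [hset2]
  refine Finset.sum_congr rfl (fun j hj => ?_)
  rw [Finset.mem_Icc] at hj
  unfold phiTerm
  rw [Nat.add_sub_cancel_left, add_assoc]

/-- `Σ_{t=1}^{d−2} demC t = Σ_{σ=1}^{k} demC σ` (both vanish outside `[1, min k (d−2)]`). -/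
lemma sum_demC_eq {p q k : ℕ} :
    ∑ t ∈ Finset.Icc 1 (p - q - 2), demC p q k t = ∑ σ ∈ Finset.Icc 1 k, demC p q k σ := by
  have h1 : ∑ t ∈ Finset.Icc 1 (p - q - 2) ∩ Finset.Icc 1 k, demC p q k t =
      ∑ t ∈ Finset.Icc 1 (p - q - 2), demC p q k t := by
    apply Finset.sum_subset Finset.inter_subset_left
    intro x hx hx'
    simp only [Finset.mem_inter, Finset.mem_Icc, not_and] at hx hx'
    unfold demC
    rw [Nat.choose_eq_zero_of_lt (by omega : k < x)]
    simp
  have h2 : ∑ t ∈ Finset.Icc 1 (p - q - 2) ∩ Finset.Icc 1 k, demC p q k t =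
      ∑ σ ∈ Finset.Icc 1 k, demC p q k σ := by
    apply Finset.sum_subset Finset.inter_subset_right
    intro x hx hx'
    simp only [Finset.mem_inter, Finset.mem_Icc, not_and] at hx hx'
    unfold demC
    rw [if_neg (by omega)]
  rw [← h1, h2]

/-- **The charging lemma**: `k·Φ(p−1,q) ≤ Σ_{σ=1}^{k} Σ_{j=1}^{d−1} dem(σ,j)`. -/
theorem mul_phiK_le_sum_dem {p q k : ℕ} (hpq : q + 2 ≤ p) (hk1 : 1 ≤ k) (hkq : k ≤ q) :
    (k : ℚ) * phiK (p - 1) q ≤ ∑ σ ∈ Finset.Icc 1 k, ∑ j ∈ Finset.Icc 1 (p - q - 1), dem p q k σ j := by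
  have hk : k + 1 ≤ p := by omega
  rw [mul_phiK_eq_sum_phiTerm hpq hk]
  -- the left side in three parts
  have hsplit : ∀ t ∈ Finset.Icc 1 (p - q - 2),
      ∑ i ∈ Finset.range (t + 1), phiTerm p q k t i =
        demB p q k t + demC p q k t + ∑ σ ∈ Finset.Icc 1 k, (if σ + 1 ≤ t then phiTerm p q k t σ else 0) := by
    intro t ht
    rw [Finset.mem_Icc] at ht
    rw [sum_range_split _ ht.1, phiTerm_zero (by omega), phiTerm_self (by omega), sum_middle_eq]
  rw [Finset.sum_congr rfl hsplit, Finset.sum_add_distrib, Finset.sum_add_distrib, Finset.sum_comm]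
  simp_rw [sum_middle_sigma_eq]
  rw [sum_demC_eq]
  -- the right side in three parts
  have hright : ∑ σ ∈ Finset.Icc 1 k, ∑ j ∈ Finset.Icc 1 (p - q - 1), dem p q k σ j =
      ∑ j ∈ Finset.Icc 1 (p - q - 1), demB p q k j +
        ∑ σ ∈ Finset.Icc 1 k, ∑ j ∈ Finset.Icc 1 (p - q - 1), demA p q k σ j +
        ∑ σ ∈ Finset.Icc 1 k, demC p q k σ := by
    unfold dem
    simp_rw [Finset.sum_add_distrib]
    have h1 : (1 : ℕ) ∈ Finset.Icc 1 k := by rw [Finset.mem_Icc]; omega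
    have h1' : (1 : ℕ) ∈ Finset.Icc 1 (p - q - 1) := by rw [Finset.mem_Icc]; omega
    rw [Finset.sum_comm (f := fun σ j => if σ = 1 then demB p q k j else 0)]
    simp_rw [Finset.sum_ite_eq', if_pos h1, if_pos h1']
  rw [hright]
  have hB : ∑ t ∈ Finset.Icc 1 (p - q - 2), demB p q k t ≤ ∑ j ∈ Finset.Icc 1 (p - q - 1), demB p q k j := by
    apply Finset.sum_le_sum_of_subset_of_nonneg
    · intro x hx
      simp only [Finset.mem_Icc] at hx ⊢
      omega
    · intro _ _ _
      exact demB_nonneg _ _ _ _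
  linarith

end PercRepro
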